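import Literature.AlgebraicGeometry.Frobenioids.ModelFrobenioidStandardProofs
import Mathlib.CategoryTheory.Discrete.Basic
import Mathlib.Algebra.Group.TypeTags.Hom
import Mathlib.Tactic.Ring
import HarnessLib

/-!
# Frobenioids I, Theorem 5.2: the model Frobenioid of `(pt, ℕ, 0, 0)` — "objects are integers" — and its
# degree calculus (the carrier of a kernel counterexample to the bare `1`-uniqueness of `Ψ^pf`, Thm. 3.4 (iii))

Mochizuki, *The geometry of Frobenioids I: the general theory*, Kyushu J. Math. **62** (2008) 293–400,
Theorem 5.2 (i)–(iii), kurims pp. 100–101 [cite: MochizukiFrdI2008, Thm. 5.2 (i) p.100]; used for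
Theorem 3.4 (iii) p. 62 in the companion file `PerfectionSquareNotOneUnique.lean` (abc-iut cell, GAP-LEDGER
row G-L1d8-2, seat abc-iut-L1-d4).

`DegreeModel.C` is the model Frobenioid ([FrdI] Thm. 5.2 (i), abc-iut-L1-t2's `ModelFrobenioid`) of the data
`(D, Φ, B, Div_B)` = (the one-morphism category `Discrete Unit`, the constant divisor monoid `(ℕ, +)`, the
zero monoid `0_D`, the zero map): objects are (base point, `α ∈ ℕ^gp ≅ ℤ`) — "integers `d`, the degree" —
and an arrow `d → e` is a pair (Frobenius degree `k ≥ 1`, zero divisor `c ∈ ℕ`) with `e = k·d + c`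
(relation (d) of Thm. 5.2 (i)).  PROVED here:
* the hypotheses of Thm. 5.2 (`hypotheses`: `(ℕ, +)` divisorial, `0_D` group-like, both monoids on the
  connected, totally epimorphic `D`), hence `C` IS A FROBENIOID (`hF`, by abc-iut-L1-t2's Thm. 5.2 (ii)
  `ModelFrobenioid.isFrobenioid`) and is OF STANDARD TYPE (`isOfStandardType`, by abc-iut-L1-t2's
  Thm. 5.2 (iii) `ModelFrobenioid.standardTypeIff_holds`: `Φ ≠ 0`, `D` of FSM-type hence FSMFF-type, `Φ`
  non-dilating);
* the degree `deg : ℕ^gp ⥲ ℤ` (`deg`, `deg_injective`), the degree law `deg(B) = deg_Fr(φ)·deg(A) + Div(φ)`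
  (`dg_eq`), and its consequences: AN ARROW OF `C` IS DETERMINED BY ITS DOMAIN, CODOMAIN AND FROBENIUS
  DEGREE (`hom_eq_of_degFr_eq`); the arrow `homOf A B k` of degree `k` exists as soon as
  `k·deg(A) ≤ deg(B)`; objects of equal degree are isomorphic (`isoOf`); `ι d`, the object of degree `d`.
No statement of the paper is strengthened; this is an instance of Thm. 5.2, not a new claim.
-/

noncomputable section

namespace Literature.AlgebraicGeometry.Frobenioids

open CategoryTheory Opposite

/-! ### The model Frobenioid of `(pt, ℕ, 0, 0)` -/

namespace DegreeModel

/-- The base category: "the category with precisely one arrow". [cite: MochizukiFrdI2008, Thm. 5.2 p.100] -/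
abbrev D : Type := Discrete Unit

/-- Its object. [cite: MochizukiFrdI2008, Thm. 5.2 p.100] -/
abbrev pt : D := ⟨()⟩

/-- Every arrow of the one-morphism category is an isomorphism. [cite: MochizukiFrdI2008, §0 p.14] -/
theorem isIso_D {X Y : D} (f : X ⟶ Y) : IsIso f :=
  ⟨⟨Discrete.eqToHom (Subsingleton.elim _ _), Subsingleton.elim _ _, Subsingleton.elim _ _⟩⟩

/-- The one-morphism category is connected. [cite: MochizukiFrdI2008, §0 p.16] -/
theorem isGraphConnected_D : IsGraphConnected D :=
  ⟨⟨pt⟩, fun X Y => by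
    cases X; cases Y
    exact Zigzag.refl _⟩

/-- The one-morphism category is totally epimorphic. [cite: MochizukiFrdI2008, §0 p.15] -/
theorem isTotallyEpimorphic_D : IsTotallyEpimorphic D :=
  ⟨fun f => by haveI := isIso_D f; infer_instance⟩

/-- The one-morphism category is of FSM-type (every arrow is invertible). [cite: MochizukiFrdI2008, §0 p.14] -/
theorem isOfFSMType_D : IsOfFSMType D := ⟨fun f _ => isIso_D f⟩

/-- The divisor monoid: `(ℕ, +)` written multiplicatively. [cite: MochizukiFrdI2008, Def. 1.1 (i) p.19] -/
abbrev N : Type := Multiplicative ℕ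

/-- `(ℕ, +)` has no units but `0`. [cite: MochizukiFrdI2008, §0 p.11] -/
theorem eq_one_of_isUnit_N (a : N) (ha : IsUnit a) : a = 1 := by
  obtain ⟨u, rfl⟩ := ha
  have h : (u : N).toAdd + ((u⁻¹ : Nˣ) : N).toAdd = 0 := by
    rw [← toAdd_mul, Units.mul_inv, toAdd_one]
  exact Multiplicative.toAdd.injective (Nat.eq_zero_of_add_eq_zero_right h)

/-- **`(ℕ, +)` is a divisorial monoid** (integral, saturated, of characteristic type, sharp).
[cite: MochizukiFrdI2008, Def. 1.1 (i) p.19] -/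
theorem isDivisorial_N : IsDivisorial N := by
  have sharp : IsSharp N := ⟨eq_one_of_isUnit_N⟩
  refine ⟨⟨⟨Algebra.GrothendieckGroup.of_injective⟩, ⟨fun x n hn ⟨c, hc⟩ => ?_⟩,
    ⟨fun u _ _ => Units.ext (sharp.1 (u : N) u.isUnit)⟩⟩, sharp⟩
  obtain ⟨⟨a, b⟩, h⟩ := (Localization.monoidOf (⊤ : Submonoid N)).surj x
  have hb : x = Algebra.GrothendieckGroup.of a / Algebra.GrothendieckGroup.of (b : N) :=
    eq_div_iff_mul_eq'.mpr h
  have hab : a ^ n = c * (b : N) ^ n := by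
    apply Algebra.GrothendieckGroup.of_injective
    rw [map_mul, map_pow, map_pow, hc, hb, div_pow, div_mul_cancel]
  have h' : n • a.toAdd = c.toAdd + n • (b : N).toAdd := by
    rw [← toAdd_pow, hab, toAdd_mul, toAdd_pow]
  have hle : (b : N).toAdd ≤ a.toAdd := by
    have h1 : n • (b : N).toAdd ≤ n • a.toAdd := by rw [h']; exact Nat.le_add_left _ _
    exact le_of_nsmul_le_nsmul_right hn.ne' h1
  obtain ⟨d, hd⟩ := Nat.exists_eq_add_of_le hle
  refine ⟨Multiplicative.ofAdd d, ?_⟩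
  rw [hb, eq_div_iff_mul_eq', ← map_mul]
  congr 1
  apply Multiplicative.toAdd.injective
  rw [toAdd_mul, toAdd_ofAdd, hd, add_comm]

/-- The divisor monoid `Φ` on `D`: constant with value `(ℕ, +)`. [cite: MochizukiFrdI2008, Def. 1.1 (ii) p.19] -/
def natΦ : Dᵒᵖ ⥤ CommMonCat.{0} := (Functor.const _).obj (CommMonCat.of N)

/-- The pull-back maps of `Φ` are identities. [cite: MochizukiFrdI2008, Def. 1.1 (ii) p.19] -/
@[simp] theorem pull_natΦ {X Y : D} (f : Y ⟶ X) (x : natΦ.obj (op X)) : pull natΦ f x = x := rfl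

/-- The pull-back maps of `Φ^gp` are identities. [cite: MochizukiFrdI2008, Thm. 5.2 (i) p.100] -/
@[simp] theorem pullGp_natΦ {X Y : D} (f : X ⟶ Y) (c : Algebra.GrothendieckGroup (natΦ.obj (op Y))) :
    pullGp natΦ f c = c := by
  have h : ∀ c' : Algebra.GrothendieckGroup N, MonGp.map (MonoidHom.id N) c' = c' := fun c' => by
    rw [MonGp.map_id, MonoidHom.id_apply]
  exact h c

/-- `Φ` is a monoid on `D` (Def. 1.1 (ii)). [cite: MochizukiFrdI2008, Def. 1.1 (ii) p.19] -/
theorem isMonoidOn_natΦ : IsMonoidOn natΦ where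
  isCharInjective f := by
    refine ⟨fun x y h => h, fun x y hxy => ?_⟩
    obtain ⟨a, rfl⟩ := Associates.mk_surjective x
    obtain ⟨b, rfl⟩ := Associates.mk_surjective y
    rw [associatesMap_mk, associatesMap_mk] at hxy
    exact hxy
  bijective_of_isFSM f _ := ⟨fun x y h => h, fun y => ⟨y, rfl⟩⟩

/-- `Φ` is objectwise divisorial. [cite: MochizukiFrdI2008, Def. 1.1 (ii) p.19] -/
theorem objectwise_isDivisorial_natΦ : Objectwise (fun M _ => IsDivisorial M) natΦ := fun _ => isDivisorial_N

/-- `Φ` is non-dilating (its pull-back maps are identities). [cite: MochizukiFrdI2008, Def. 1.1 (ii) p.19] -/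
theorem isNonDilatingOn_natΦ : IsNonDilatingOn natΦ := by
  intro A α _
  refine MonoidHom.ext fun a => ?_
  obtain ⟨a, rfl⟩ := Associates.mk_surjective a
  rw [associatesMap_mk]
  rfl

/-- `Φ` is not the zero monoid. [cite: MochizukiFrdI2008, Thm. 5.2 (iii) p.101] -/
theorem not_isZeroMonoid_natΦ : ¬ ModelFrobenioid.IsZeroMonoid natΦ := fun h =>
  Nat.one_ne_zero (congrArg Multiplicative.toAdd (h (op pt) (Multiplicative.ofAdd (1 : ℕ))) : (1 : ℕ) = 0)

/-- The rational function monoid: the zero monoid `0_D`. [cite: MochizukiFrdI2008, Thm. 5.2 p.100] -/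
abbrev B : Dᵒᵖ ⥤ CommMonCat.{0} := zeroMonoid D

/-- The values of `B` have one element. [cite: MochizukiFrdI2008, Prop. 4.4 (i) p.83] -/
theorem subsingleton_B_obj (A : Dᵒᵖ) : Subsingleton (B.obj A) := inferInstanceAs (Subsingleton PUnit)

/-- `B = 0_D` is a monoid on `D`. [cite: MochizukiFrdI2008, Def. 1.1 (ii) p.19] -/
theorem isMonoidOn_B : IsMonoidOn B where
  isCharInjective := fun {X Y} _ =>
    haveI := subsingleton_B_obj (op X)
    ⟨fun a b _ => Subsingleton.elim a b, fun a b _ => by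
      obtain ⟨a, rfl⟩ := Associates.mk_surjective a
      obtain ⟨b, rfl⟩ := Associates.mk_surjective b
      rw [Subsingleton.elim a b]⟩
  bijective_of_isFSM := fun {X Y} _ _ =>
    haveI := subsingleton_B_obj (op X)
    haveI := subsingleton_B_obj (op Y)
    ⟨fun a b _ => Subsingleton.elim a b, fun b => ⟨1, Subsingleton.elim _ b⟩⟩

/-- A one-element monoid is group-like (Def. 1.1 (i)). [cite: MochizukiFrdI2008, Def. 1.1 (i) p.19] -/
theorem isGroupLike_of_subsingleton (S : Type) [CommMonoid S] [Subsingleton S] : IsGroupLike S where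
  isPreDivisorial :=
    { isIntegral := ⟨fun a b _ => Subsingleton.elim a b⟩
      isSaturated := ⟨fun x _ _ _ => by
        induction x using Localization.induction_on with
        | H p =>
          obtain ⟨a, s⟩ := p
          refine ⟨1, ?_⟩
          rw [Subsingleton.elim a 1, show s = 1 from Subtype.ext (Subsingleton.elim _ _),
            Localization.mk_one, map_one]⟩
      isOfCharType := ⟨fun u _ _ => Units.ext (Subsingleton.elim _ _)⟩ }
  subsingleton_associates := ⟨fun x y => by
    obtain ⟨a, rfl⟩ := Associates.mk_surjective x
    obtain ⟨b, rfl⟩ := Associates.mk_surjective y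
    rw [Subsingleton.elim a b]⟩

/-- `B = 0_D` is objectwise group-like. [cite: MochizukiFrdI2008, Def. 1.1 (ii) p.19] -/
theorem objectwise_isGroupLike_B : Objectwise (fun M _ => IsGroupLike M) B := fun A =>
  haveI := subsingleton_B_obj (op A)
  isGroupLike_of_subsingleton (B.obj (op A))

/-- `Div_B = 0 : B → Φ^gp`. [cite: MochizukiFrdI2008, Thm. 5.2 p.100] -/
def DivB : B ⟶ monoidGp natΦ where
  app _ := CommMonCat.ofHom 1
  naturality X Y f := by
    apply CommMonCat.hom_ext
    apply MonoidHom.ext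
    intro x
    change (1 : B.obj Y →* (monoidGp natΦ).obj Y) ((B.map f).hom x) =
      ((monoidGp natΦ).map f).hom ((1 : B.obj X →* (monoidGp natΦ).obj X) x)
    rw [MonoidHom.one_apply, MonoidHom.one_apply, map_one]

/-- `Div_B(u) = 0`. [cite: MochizukiFrdI2008, Thm. 5.2 p.100] -/
@[simp] theorem divB_eq_one (A : Dᵒᵖ) (u : B.obj A) : divB natΦ B DivB A u = 1 := rfl

/-- The hypotheses of Thm. 5.2 hold for `(D, Φ, B)`. [cite: MochizukiFrdI2008, Thm. 5.2 p.100] -/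
theorem hypotheses : ModelFrobenioid.Hypotheses natΦ B where
  isMonoidOn := isMonoidOn_natΦ
  isDivisorial := objectwise_isDivisorial_natΦ
  isMonoidOn_rat := isMonoidOn_B
  isGroupLike_rat := objectwise_isGroupLike_B
  isGraphConnected := isGraphConnected_D
  isTotallyEpimorphic := isTotallyEpimorphic_D

/-- The model Frobenioid `C` of `(D, Φ, B, Div_B)` (Thm. 5.2 (i)). [cite: MochizukiFrdI2008, Thm. 5.2 (i) p.100] -/
abbrev C : Type := ModelFrobenioid natΦ B DivB

/-- Its pre-Frobenioid structure `C → F_Φ`. [cite: MochizukiFrdI2008, Thm. 5.2 (i) p.100] -/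
abbrev F : C ⥤ ElemFrobenioid natΦ := ModelFrobenioid.toElem natΦ B DivB

/-- **`C` is a Frobenioid** (Thm. 5.2 (ii), abc-iut-L1-t2). [cite: MochizukiFrdI2008, Thm. 5.2 (ii) p.101] -/
theorem hF : PreFrobenioid.IsFrobenioid F :=
  ModelFrobenioid.isFrobenioid isMonoidOn_natΦ objectwise_isDivisorial_natΦ isMonoidOn_B objectwise_isGroupLike_B
    isGraphConnected_D isTotallyEpimorphic_D

/-- **`C` is of standard type** (Thm. 5.2 (iii), abc-iut-L1-t2: `Φ ≠ 0`, `D` of FSMFF-type, `Φ`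
non-dilating). [cite: MochizukiFrdI2008, Thm. 5.2 (iii) p.101] -/
theorem isOfStandardType : (ModelFrobenioid.data natΦ B DivB).IsOfStandardType :=
  (ModelFrobenioid.standardTypeIff_holds natΦ B DivB hypotheses).mpr
    ⟨fun h0 => (not_isZeroMonoid_natΦ h0).elim, isOfFSMType_D.isOfFSMFFType, isNonDilatingOn_natΦ⟩

/-! ### The degree of an object -/

/-- The degree `Φ^gp(pt) = ℕ^gp → ℤ`. [cite: MochizukiFrdI2008, Thm. 5.2 (i) p.100] -/
def deg : Algebra.GrothendieckGroup N →* Multiplicative ℤ :=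
  Algebra.GrothendieckGroup.lift (AddMonoidHom.toMultiplicative (Nat.castAddMonoidHom ℤ))

/-- `deg` on `ℕ ⊆ ℕ^gp` is the cast. [cite: MochizukiFrdI2008, Thm. 5.2 (i) p.100] -/
@[simp] theorem deg_of (a : N) :
    deg (Algebra.GrothendieckGroup.of a) = Multiplicative.ofAdd (a.toAdd : ℤ) := by
  have h := Algebra.GrothendieckGroup.lift.symm_apply_apply
    (AddMonoidHom.toMultiplicative (Nat.castAddMonoidHom ℤ) : N →* Multiplicative ℤ)
  rw [Algebra.GrothendieckGroup.lift_symm_apply] at h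
  have h' := DFunLike.congr_fun h a
  rw [MonoidHom.comp_apply, AddMonoidHom.toMultiplicative_apply_apply] at h'
  exact h'

/-- `deg` is injective (`ℕ^gp ≅ ℤ`). [cite: MochizukiFrdI2008, Thm. 5.2 (i) p.100] -/
theorem deg_injective : Function.Injective deg := by
  refine (injective_iff_map_eq_one deg).mpr fun x hx => ?_
  obtain ⟨⟨a, b⟩, h⟩ := (Localization.monoidOf (⊤ : Submonoid N)).surj x
  have hb : x = Algebra.GrothendieckGroup.of a / Algebra.GrothendieckGroup.of (b : N) :=
    eq_div_iff_mul_eq'.mpr h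
  rw [hb, map_div, deg_of, deg_of, div_eq_one] at hx
  have hab : a = (b : N) := by
    apply Multiplicative.toAdd.injective
    exact_mod_cast (Multiplicative.ofAdd.injective hx)
  rw [hb, hab, div_self']

/-- The class `α ∈ ℕ^gp` of an object `A = (pt, α)` of `C` (retyped at `ℕ^gp`). [cite: MochizukiFrdI2008, Thm. 5.2 (i) p.100] -/
def cls (X : C) : Algebra.GrothendieckGroup N := X.cls

/-- The zero divisor `Div(φ) ∈ ℕ` of an arrow of `C` (retyped at `ℕ`). [cite: MochizukiFrdI2008, Thm. 5.2 (i) p.100] -/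
def dv {X Y : C} (φ : X ⟶ Y) : N := ModelFrobenioid.div φ

/-- The degree `deg(A) ∈ ℤ` of an object `A = (pt, α)` of `C`. [cite: MochizukiFrdI2008, Thm. 5.2 (i) p.100] -/
def dg (X : C) : ℤ := (deg (cls X)).toAdd

/-- The relation of a morphism, simplified: `α ^ deg_Fr(φ) · Div(φ) = β`.
[cite: MochizukiFrdI2008, Thm. 5.2 (i) p.100] -/
theorem rel' {X Y : C} (φ : X ⟶ Y) :
    cls X ^ (ModelFrobenioid.degFr φ : ℕ) * Algebra.GrothendieckGroup.of (dv φ) = cls Y := by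
  have h := ModelFrobenioid.rel φ
  rw [pullGp_natΦ, divB_eq_one, mul_one] at h
  exact h

/-- **The degree law**: for `φ : A → B`, `deg(B) = deg_Fr(φ) · deg(A) + Div(φ)`.
[cite: MochizukiFrdI2008, Thm. 5.2 (i) p.100] -/
theorem dg_eq {X Y : C} (φ : X ⟶ Y) :
    dg Y = (ModelFrobenioid.degFr φ : ℕ) * dg X + ((dv φ).toAdd : ℤ) := by
  have h := congrArg (fun g => (deg g).toAdd) (rel' φ)
  simp only [map_mul, map_pow, deg_of, toAdd_mul, toAdd_pow, toAdd_ofAdd, nsmul_eq_mul] at h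
  unfold dg
  rw [← h]

/-- Hence `deg_Fr(φ) · deg(A) ≤ deg(B)`. [cite: MochizukiFrdI2008, Thm. 5.2 (i) p.100] -/
theorem degFr_mul_dg_le {X Y : C} (φ : X ⟶ Y) : (ModelFrobenioid.degFr φ : ℕ) * dg X ≤ dg Y := by
  rw [dg_eq φ]
  exact le_add_of_nonneg_right (Int.natCast_nonneg _)

/-- **In `C` an arrow is determined by its domain, codomain and Frobenius degree** (the base has one
arrow, `B = 0`, and the zero divisor is forced by the relation). [cite: MochizukiFrdI2008, Thm. 5.2 (i) p.100] -/
theorem hom_eq_of_degFr_eq {X Y : C} (φ ψ : X ⟶ Y) (h : ModelFrobenioid.degFr φ = ModelFrobenioid.degFr ψ) :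
    φ = ψ := by
  haveI := subsingleton_B_obj (op X.base)
  refine ModelFrobenioid.hom_ext h (Subsingleton.elim _ _) ?_ (Subsingleton.elim _ _)
  change dv φ = dv ψ
  apply Algebra.GrothendieckGroup.of_injective
  have h₁ := rel' φ
  rw [h] at h₁
  exact mul_left_cancel (h₁.trans (rel' ψ).symm)

/-- The arrow `A → B` of Frobenius degree `k` (it exists iff `k · deg(A) ≤ deg(B)`).
[cite: MochizukiFrdI2008, Thm. 5.2 (i) p.100] -/
def homOf (X Y : C) (k : ℕ+) (h : (k : ℕ) * dg X ≤ dg Y) : X ⟶ Y :=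
  ModelFrobenioid.mkHom X Y k (Discrete.eqToHom (Subsingleton.elim _ _))
    (Multiplicative.ofAdd (dg Y - (k : ℕ) * dg X).toNat : N) 1 (by
      rw [pullGp_natΦ, divB_eq_one, mul_one]
      change cls X ^ (k : ℕ) * Algebra.GrothendieckGroup.of (Multiplicative.ofAdd (dg Y - (k : ℕ) * dg X).toNat) =
        cls Y
      apply deg_injective
      apply Multiplicative.toAdd.injective
      simp only [map_mul, map_pow, deg_of, toAdd_mul, toAdd_pow, toAdd_ofAdd, nsmul_eq_mul]
      change (k : ℕ) * dg X + (((dg Y - (k : ℕ) * dg X).toNat : ℕ) : ℤ) = dg Y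
      rw [Int.toNat_of_nonneg (sub_nonneg.mpr h)]
      ring)

/-- `deg_Fr` of `homOf`. [cite: MochizukiFrdI2008, Thm. 5.2 (i) p.100] -/
@[simp] theorem degFr_homOf (X Y : C) (k : ℕ+) (h : (k : ℕ) * dg X ≤ dg Y) :
    ModelFrobenioid.degFr (homOf X Y k h) = k := rfl

/-- Objects of equal degree are isomorphic (by the degree-one arrows). [cite: MochizukiFrdI2008, Thm. 5.2 (i) p.100] -/
def isoOf (X Y : C) (h : dg X = dg Y) : X ≅ Y where
  hom := homOf X Y 1 (by rw [PNat.one_coe, Nat.cast_one, one_mul, h])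
  inv := homOf Y X 1 (by rw [PNat.one_coe, Nat.cast_one, one_mul, h])
  hom_inv_id := hom_eq_of_degFr_eq _ _ rfl
  inv_hom_id := hom_eq_of_degFr_eq _ _ rfl

/-- The generator `1 ∈ ℕ ⊆ ℕ^gp`. [cite: MochizukiFrdI2008, Thm. 5.2 (i) p.100] -/
def gen : Algebra.GrothendieckGroup N := Algebra.GrothendieckGroup.of (Multiplicative.ofAdd 1)

/-- The object `ι d = (pt, d)` of degree `d ∈ ℤ`. [cite: MochizukiFrdI2008, Thm. 5.2 (i) p.100] -/
def ι (d : ℤ) : C := ⟨pt, gen ^ d⟩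

/-- `deg(ι d) = d`. [cite: MochizukiFrdI2008, Thm. 5.2 (i) p.100] -/
@[simp] theorem dg_ι (d : ℤ) : dg (ι d) = d := by
  change (deg (gen ^ d)).toAdd = d
  unfold gen
  rw [map_zpow, deg_of, toAdd_zpow, toAdd_ofAdd, toAdd_ofAdd, Nat.cast_one, smul_eq_mul, mul_one]

end DegreeModel

end Literature.AlgebraicGeometry.Frobenioids

end
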